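import Literature.Analysis.InverseSpectral.HelicalFunctionProofsLattice
import HarnessLib

/-!
# Kreĭn's representation theorem: the dyadic lattice package

Fourth file of the proof of `Literature.Analysis.InverseSpectral.KreinHelicalRepresentation`
(Arov–Dym 2012, Thm 9.1). Given `a > 0`, a star-shaped symmetric set `S ⊇ [-a, a]`, a function
`g` continuous and Hermitian on `S`, and for every level `n` a positive-definite sequence `Dₙ`
on `ℤ` which agrees with the second differences of `j ↦ g(j hₙ)`, `hₙ = a/2^{n+3}`, wherever
these samples lie in `S`, we run the one-lattice analysis of `HelicalFunctionProofsLattice` on the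
dyadic meshes `hₙ` with Fejér orders `Mₙ = 2^{4(n+3)}` and package the output
(`exists_lattice_package`):

* finite measures `ρₙ` on `ℝ` and purely imaginary coefficients `Aₙ` with uniformly bounded
  masses and moduli,
* the family `(ρₙ)` uniformly tight at infinity (tails controlled by the modulus of continuity of
  `g` at `0`, via the Dirichlet-kernel averaging of `measure_tail_le`),
* and, at every dyadic point `t = j a/2^m ∈ S`, the representation
  `g(t) = g(0) + t Aₙ + ∫ F(t, x) dρₙ(x) + o(1)` as `n → ∞` (`F(t, x) = h(t, x)(1 + x²)`).

The compactness argument (Prokhorov) and the assembly of Kreĭn's formula are in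
`HelicalFunctionProofs`.

## References

* D. Z. Arov, H. Dym, *Bitangential direct and inverse problems…*, CUP 2012, Thm 9.1.
-/

open MeasureTheory Set Complex Filter Finset Literature.Analysis.FunctionSpaces
open scoped ComplexConjugate ENNReal NNReal Topology BigOperators ComplexOrder

noncomputable section

namespace Literature.Analysis.InverseSpectral

section Level

variable {S : Set ℝ} {g : ℝ → ℂ} {h : ℝ} {D : ℤ → ℂ} {M : ℕ} {ν : Measure ℝ} [IsFiniteMeasure ν]

/-- The lattice representation at `kh ∈ S`, `k ≥ 0`, with the data-validity hypothesis phrased on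
the star-shaped set `S`. [folklore] -/
theorem rep_lattice_of_mem (hh : 0 < h) (hstar : ∀ t ∈ S, ∀ s : ℝ, |s| ≤ |t| → s ∈ S)
    (hD : IsPositiveDefinite D) (hM : 0 < M) (hac : ν ≪ volume)
    (hsupp : ν (Set.Ioc (-Real.pi) Real.pi)ᶜ = 0)
    (hcoef : ∀ j : ℤ, j.natAbs ≤ M →
      ∫ θ, cexp (-(I * j * θ)) ∂ν = ((M - j.natAbs : ℕ) : ℂ) / M * D j)
    (hDd : ∀ j : ℤ, (|(j : ℝ)| + 1) * h ∈ S →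
      D j = 2 * g (j * h) - g ((j + 1) * h) - g ((j - 1) * h))
    {k : ℕ} (hkM : k ≤ M) (hkS : (k : ℝ) * h ∈ S) :
    ‖g (k * h) - (g 0 + ((k * h : ℝ) : ℂ) * (((g 0 - g (-h)) - ∫ θ, (((1 - cexp (I * ((θ) : ℂ))) + I * ((θ) : ℂ) / (((1 : ℝ) + ((θ) / (h)) ^ 2 : ℝ) : ℂ)) / (((2 : ℝ) - 2 * Real.cos (θ) : ℝ) : ℂ)) ∂ν) / h) +
        ∫ x, (kreinHelicalIntegrand (k * h) (x) * (((1 : ℝ) + (x) ^ 2 : ℝ) : ℂ)) ∂((MeasureTheory.Measure.withDensity (MeasureTheory.Measure.map (fun θ : ℝ => θ / (h)) (ν)) (fun x : ℝ => ENNReal.ofReal (x ^ 2 / (((2 : ℝ) - 2 * Real.cos ((h) * x)) * (1 + x ^ 2)))))))‖ ≤ (k : ℝ) ^ 3 * (D 0).re / M := by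
  refine lattice_rep hh hD hM hac hsupp hcoef hkM fun j hj => ?_
  have hmem : (|((j : ℤ) : ℝ)| + 1) * h ∈ S := by
    refine hstar _ hkS _ ?_
    have hj1 : (j : ℝ) + 1 ≤ k := by exact_mod_cast hj
    rw [Int.cast_natCast, abs_of_nonneg (by positivity : (0 : ℝ) ≤ j),
      abs_of_nonneg (by positivity), abs_of_nonneg (by positivity)]
    exact mul_le_mul_of_nonneg_right hj1 hh.le
  have := hDd (j : ℤ) hmem
  simpa using this

/-- The lattice representation at `-kh`, `kh ∈ S`, `k ≥ 0`, obtained from `rep_lattice_of_mem`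
by conjugation (`g` Hermitian, `Re A = 0`, `conj F(t, ·) = F(-t, ·)`). [folklore] -/
theorem rep_lattice_neg_of_mem (hh : 0 < h) (hstar : ∀ t ∈ S, ∀ s : ℝ, |s| ≤ |t| → s ∈ S)
    (hherm : ∀ t ∈ S, g (-t) = conj (g t))
    (hD : IsPositiveDefinite D) (hM : 0 < M) (hac : ν ≪ volume)
    (hsupp : ν (Set.Ioc (-Real.pi) Real.pi)ᶜ = 0)
    (hcoef : ∀ j : ℤ, j.natAbs ≤ M →
      ∫ θ, cexp (-(I * j * θ)) ∂ν = ((M - j.natAbs : ℕ) : ℂ) / M * D j)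
    (hDd : ∀ j : ℤ, (|(j : ℝ)| + 1) * h ∈ S →
      D j = 2 * g (j * h) - g ((j + 1) * h) - g ((j - 1) * h))
    (hA : ((((g 0 - g (-h)) - ∫ θ, (((1 - cexp (I * ((θ) : ℂ))) + I * ((θ) : ℂ) / (((1 : ℝ) + ((θ) / (h)) ^ 2 : ℝ) : ℂ)) / (((2 : ℝ) - 2 * Real.cos (θ) : ℝ) : ℂ)) ∂ν) / h)).re = 0)
    {k : ℕ} (hkM : k ≤ M) (hkS : (k : ℝ) * h ∈ S) :
    ‖g (-(k * h)) - (g 0 + ((-(k * h) : ℝ) : ℂ) * (((g 0 - g (-h)) - ∫ θ, (((1 - cexp (I * ((θ) : ℂ))) + I * ((θ) : ℂ) / (((1 : ℝ) + ((θ) / (h)) ^ 2 : ℝ) : ℂ)) / (((2 : ℝ) - 2 * Real.cos (θ) : ℝ) : ℂ)) ∂ν) / h) +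
        ∫ x, (kreinHelicalIntegrand (-(k * h)) (x) * (((1 : ℝ) + (x) ^ 2 : ℝ) : ℂ)) ∂((MeasureTheory.Measure.withDensity (MeasureTheory.Measure.map (fun θ : ℝ => θ / (h)) (ν)) (fun x : ℝ => ENNReal.ofReal (x ^ 2 / (((2 : ℝ) - 2 * Real.cos ((h) * x)) * (1 + x ^ 2)))))))‖ ≤ (k : ℝ) ^ 3 * (D 0).re / M := by
  have hrep := rep_lattice_of_mem hh hstar hD hM hac hsupp hcoef hDd hkM hkS
  haveI : IsFiniteMeasure ((MeasureTheory.Measure.withDensity (MeasureTheory.Measure.map (fun θ : ℝ => θ / (h)) (ν)) (fun x : ℝ => ENNReal.ofReal (x ^ 2 / (((2 : ℝ) - 2 * Real.cos ((h) * x)) * (1 + x ^ 2)))))) := isFiniteMeasure_rho hh hac hsupp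
  set A : ℂ := ((g 0 - g (-h)) - ∫ θ, (((1 - cexp (I * ((θ) : ℂ))) + I * ((θ) : ℂ) / (((1 : ℝ) + ((θ) / (h)) ^ 2 : ℝ) : ℂ)) / (((2 : ℝ) - 2 * Real.cos (θ) : ℝ) : ℂ)) ∂ν) / h with hAdef
  have h0S : (0 : ℝ) ∈ S := hstar _ hkS 0 (by rw [abs_zero]; exact abs_nonneg _)
  have hg0 : conj (g 0) = g 0 := by simpa using (hherm 0 h0S).symm
  have hconjA : conj A = -A := by
    apply Complex.ext <;> simp [hA]
  have hkey : g (-(k * h)) - (g 0 + ((-(k * h) : ℝ) : ℂ) * A + ∫ x, (kreinHelicalIntegrand (-(k * h)) (x) * (((1 : ℝ) + (x) ^ 2 : ℝ) : ℂ)) ∂((MeasureTheory.Measure.withDensity (MeasureTheory.Measure.map (fun θ : ℝ => θ / (h)) (ν)) (fun x : ℝ => ENNReal.ofReal (x ^ 2 / (((2 : ℝ) - 2 * Real.cos ((h) * x)) * (1 + x ^ 2))))))) =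
      conj (g (k * h) - (g 0 + ((k * h : ℝ) : ℂ) * A + ∫ x, (kreinHelicalIntegrand (k * h) (x) * (((1 : ℝ) + (x) ^ 2 : ℝ) : ℂ)) ∂((MeasureTheory.Measure.withDensity (MeasureTheory.Measure.map (fun θ : ℝ => θ / (h)) (ν)) (fun x : ℝ => ENNReal.ofReal (x ^ 2 / (((2 : ℝ) - 2 * Real.cos ((h) * x)) * (1 + x ^ 2)))))))) := by
    rw [map_sub, map_add, map_add, map_mul, Complex.conj_ofReal, hconjA, hg0,
      conj_integral_F, hherm _ hkS]
    push_cast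
    ring
  rw [hkey, Complex.norm_conj]
  exact hrep

end Level

/-! ### The dyadic lattice package -/

section Package

variable {a : ℝ} {S : Set ℝ} {g : ℝ → ℂ} {D : ℕ → ℤ → ℂ}

/-- Dyadic bookkeeping: `j · 2^{n+3-m} · (a/2^{n+3}) = j a/2^m` for `m ≤ n + 3`. [folklore] -/
lemma dyadic_mesh_eq (a : ℝ) {m n : ℕ} (hmn : m ≤ n + 3) (j : ℤ) :
    ((j * 2 ^ (n + 3 - m) : ℤ) : ℝ) * (a / 2 ^ (n + 3)) = j * (a / 2 ^ m) := by
  have h2 : (2 : ℝ) ^ (n + 3) = 2 ^ m * 2 ^ (n + 3 - m) := by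
    rw [← pow_add, Nat.add_sub_cancel' hmn]
  push_cast
  rw [h2]
  field_simp

/-- Dyadic bookkeeping, natural-number version: `q · 2^{n+3-m} · (a/2^{n+3}) = q a/2^m` for
`m ≤ n + 3`. [folklore] -/
lemma dyadic_mesh_eq_nat (a : ℝ) {m n : ℕ} (hmn : m ≤ n + 3) (q : ℕ) :
    ((q * 2 ^ (n + 3 - m) : ℕ) : ℝ) * (a / 2 ^ (n + 3)) = q * (a / 2 ^ m) := by
  have h2 : (2 : ℝ) ^ (n + 3) = 2 ^ m * 2 ^ (n + 3 - m) := by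
    rw [← pow_add, Nat.add_sub_cancel' hmn]
  push_cast
  rw [h2]
  field_simp

/-- **The dyadic lattice package.** See the module docstring. [folklore] -/
theorem exists_lattice_package (ha : 0 < a) (hIcc : Set.Icc (-a) a ⊆ S)
    (hstar : ∀ t ∈ S, ∀ s : ℝ, |s| ≤ |t| → s ∈ S)
    (hg : ContinuousOn g S) (hherm : ∀ t ∈ S, g (-t) = conj (g t))
    (hD : ∀ n, IsPositiveDefinite (D n))
    (hDd : ∀ (n : ℕ) (j : ℤ), (|(j : ℝ)| + 1) * (a / 2 ^ (n + 3)) ∈ S →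
      D n j = 2 * g (j * (a / 2 ^ (n + 3))) - g ((j + 1) * (a / 2 ^ (n + 3))) -
        g ((j - 1) * (a / 2 ^ (n + 3)))) :
    ∃ (ρ : ℕ → Measure ℝ) (A : ℕ → ℂ), (∀ n, IsFiniteMeasure (ρ n)) ∧ (∀ n, (A n).re = 0) ∧
      (∃ C : ℝ, ∀ n, (ρ n).real Set.univ ≤ C) ∧ (∃ C : ℝ, ∀ n, ‖A n‖ ≤ C) ∧
      (∀ ε : ℝ, 0 < ε → ∃ R : ℝ, ∀ᶠ n in atTop, (ρ n).real {x | R ≤ |x|} ≤ ε) ∧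
      (∀ (m : ℕ) (j : ℤ), (j : ℝ) * (a / 2 ^ m) ∈ S →
        Tendsto (fun n => g (j * (a / 2 ^ m)) - (g 0 + ((j * (a / 2 ^ m) : ℝ) : ℂ) * A n +
          ∫ x, (kreinHelicalIntegrand (j * (a / 2 ^ m)) (x) * (((1 : ℝ) + (x) ^ 2 : ℝ) : ℂ)) ∂(ρ n))) atTop (𝓝 0)) := by
  -- meshes and Fejér orders
  set hh : ℕ → ℝ := fun n => a / 2 ^ (n + 3) with hhdef
  have hpos : ∀ n, 0 < hh n := fun n => by positivity
  have hNh : ∀ n, ((2 ^ (n + 3) : ℕ) : ℝ) * hh n = a := fun n => by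
    simp only [hhdef]; push_cast; field_simp
  have hle : ∀ n, hh n ≤ a / 8 := fun n => by
    simp only [hhdef]
    apply div_le_div_of_nonneg_left ha.le (by norm_num)
    calc (8 : ℝ) = 2 ^ 3 := by norm_num
      _ ≤ 2 ^ (n + 3) := pow_le_pow_right₀ (by norm_num) (by omega)
  have hMpos : ∀ n : ℕ, 0 < (2 : ℕ) ^ (4 * (n + 3)) := fun n => by positivity
  -- the Fejér measures
  choose ν hν using fun n => exists_fejer_measure (hD n) (hMpos n)
  have hfin : ∀ n, IsFiniteMeasure (ν n) := fun n => (hν n).1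
  have hac : ∀ n, ν n ≪ volume := fun n => (hν n).2.1
  have hsupp : ∀ n, ν n (Set.Ioc (-Real.pi) Real.pi)ᶜ = 0 := fun n => (hν n).2.2.1
  have hcoef : ∀ n, ∀ j : ℤ, j.natAbs ≤ 2 ^ (4 * (n + 3)) →
      ∫ θ, cexp (-(I * j * θ)) ∂(ν n) =
        ((2 ^ (4 * (n + 3)) - j.natAbs : ℕ) : ℂ) / (2 ^ (4 * (n + 3)) : ℕ) * D n j :=
    fun n => (hν n).2.2.2
  -- the rescaled measures and the coefficients
  set ρ : ℕ → Measure ℝ := fun n => (MeasureTheory.Measure.withDensity (MeasureTheory.Measure.map (fun θ : ℝ => θ / (hh n)) (ν n)) (fun x : ℝ => ENNReal.ofReal (x ^ 2 / (((2 : ℝ) - 2 * Real.cos ((hh n) * x)) * (1 + x ^ 2))))) with hρdef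
  set A : ℕ → ℂ := fun n => ((g 0 - g (-(hh n))) - ∫ θ, (((1 - cexp (I * ((θ) : ℂ))) + I * ((θ) : ℂ) / (((1 : ℝ) + ((θ) / (hh n)) ^ 2 : ℝ) : ℂ)) / (((2 : ℝ) - 2 * Real.cos (θ) : ℝ) : ℂ)) ∂(ν n)) / (hh n) with hAdef
  have hρfin : ∀ n, IsFiniteMeasure (ρ n) := fun n => by
    haveI := hfin n
    exact isFiniteMeasure_rho (hpos n) (hac n) (hsupp n)
  -- membership facts
  have hmemS : ∀ s : ℝ, |s| ≤ a → s ∈ S := fun s hs => hIcc (abs_le.1 hs)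
  have h0S : (0 : ℝ) ∈ S := hmemS 0 (by simp [ha.le])
  have hhS : ∀ n, hh n ∈ S := fun n => hmemS _ (by rw [abs_of_pos (hpos n)]; linarith [hle n])
  have hDdn : ∀ n (j : ℤ), (|(j : ℝ)| + 1) * hh n ∈ S →
      D n j = 2 * g (j * hh n) - g ((j + 1) * hh n) - g ((j - 1) * hh n) := fun n j hj =>
    hDd n j hj
  have hD0 : ∀ n, D n 0 = 2 * g 0 - g (hh n) - g (-(hh n)) := by
    intro n
    have := hDdn n 0 (by simpa using hhS n)
    simpa using this
  -- `Re A = 0`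
  have hAre : ∀ n, (A n).re = 0 := by
    intro n
    haveI := hfin n
    exact re_latticeCoeff_eq_zero (hpos n) (hMpos n) (hac n) (hsupp n) (hcoef n) (hD0 n)
      (hherm _ (hhS n))
  -- a uniform bound for `g` on `[-a, a]` and for `D n 0`
  obtain ⟨G, hG⟩ := isCompact_Icc.exists_bound_of_continuousOn (hg.mono hIcc)
  have hG0 : 0 ≤ G := (norm_nonneg _).trans (hG 0 ⟨by linarith, ha.le⟩)
  have hGS : ∀ s : ℝ, |s| ≤ a → ‖g s‖ ≤ G := fun s hs => hG s (abs_le.1 hs)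
  have hD0re : ∀ n, (D n 0).re ≤ 4 * G := by
    intro n
    refine (Complex.re_le_norm _).trans ?_
    rw [hD0 n]
    have h1 := hGS 0 (by simp [ha.le])
    have h2 := hGS (hh n) (by rw [abs_of_pos (hpos n)]; linarith [hle n])
    have h3 := hGS (-(hh n)) (by rw [abs_neg, abs_of_pos (hpos n)]; linarith [hle n])
    calc ‖2 * g 0 - g (hh n) - g (-hh n)‖ ≤ ‖2 * g 0‖ + ‖g (hh n)‖ + ‖g (-hh n)‖ :=
          (norm_sub_le _ _).trans (add_le_add (norm_sub_le _ _) le_rfl)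
      _ ≤ 2 * G + G + G := by rw [norm_mul, Complex.norm_two]; linarith
      _ = 4 * G := by ring
  have hD0nn : ∀ n, 0 ≤ (D n 0).re := fun n => (hD n).apply_zero_re_nonneg
  -- the representation at `± kh ∈ S`
  have hrep : ∀ n (k : ℕ), k ≤ 2 ^ (4 * (n + 3)) → (k : ℝ) * hh n ∈ S →
      ‖g (k * hh n) - (g 0 + ((k * hh n : ℝ) : ℂ) * A n + ∫ x, (kreinHelicalIntegrand (k * hh n) (x) * (((1 : ℝ) + (x) ^ 2 : ℝ) : ℂ)) ∂(ρ n))‖ ≤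
        (k : ℝ) ^ 3 * (4 * G) / (2 ^ (4 * (n + 3)) : ℕ) := by
    intro n k hk hkS
    haveI := hfin n
    refine (rep_lattice_of_mem (hpos n) hstar (hD n) (hMpos n) (hac n) (hsupp n) (hcoef n)
      (hDdn n) hk hkS).trans ?_
    gcongr
    exact hD0re n
  have hrep_neg : ∀ n (k : ℕ), k ≤ 2 ^ (4 * (n + 3)) → (k : ℝ) * hh n ∈ S →
      ‖g (-(k * hh n)) - (g 0 + ((-(k * hh n) : ℝ) : ℂ) * A n + ∫ x, (kreinHelicalIntegrand (-(k * hh n)) (x) * (((1 : ℝ) + (x) ^ 2 : ℝ) : ℂ)) ∂(ρ n))‖ ≤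
        (k : ℝ) ^ 3 * (4 * G) / (2 ^ (4 * (n + 3)) : ℕ) := by
    intro n k hk hkS
    haveI := hfin n
    refine (rep_lattice_neg_of_mem (hpos n) hstar hherm (hD n) (hMpos n) (hac n) (hsupp n)
      (hcoef n) (hDdn n) (hAre n) hk hkS).trans ?_
    gcongr
    exact hD0re n
  -- uniform error for `k ≤ N_n = 2^(n+3)`: `N³ · 4G / N⁴ = 4G/N`
  have herrN : ∀ n (k : ℕ), k ≤ 2 ^ (n + 3) →
      (k : ℝ) ^ 3 * (4 * G) / (2 ^ (4 * (n + 3)) : ℕ) ≤ 4 * G / 2 ^ (n + 3) := by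
    intro n k hk
    have hk' : (k : ℝ) ≤ 2 ^ (n + 3) := by exact_mod_cast hk
    push_cast
    rw [show (2 : ℝ) ^ (4 * (n + 3)) = (2 ^ (n + 3)) ^ 3 * 2 ^ (n + 3) by ring,
      div_le_div_iff₀ (by positivity) (by positivity)]
    have : (k : ℝ) ^ 3 ≤ (2 ^ (n + 3)) ^ 3 := by gcongr
    have h5 := mul_le_mul_of_nonneg_right this (by positivity : (0 : ℝ) ≤ 4 * G * 2 ^ (n + 3))
    linarith
  have hNle : ∀ n, 2 ^ (n + 3) ≤ 2 ^ (4 * (n + 3)) := fun n =>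
    Nat.pow_le_pow_right (by norm_num) (by omega)
  have hkS_of_le : ∀ n (k : ℕ), k ≤ 2 ^ (n + 3) → (k : ℝ) * hh n ∈ S := by
    intro n k hk
    apply hmemS
    rw [abs_of_nonneg (by positivity : (0 : ℝ) ≤ k * hh n), ← hNh n]
    gcongr
  -- the tail bound at radius `2π/a` and the central bound at radius `8/a`
  have hπ4 : Real.pi ≤ 4 := Real.pi_le_four
  have htail0 : ∀ n, (ρ n).real {x | 2 * Real.pi / a ≤ |x|} ≤ 2 * (2 * G) + 2 * (4 * G / 2 ^ (n + 3)) := by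
    intro n
    haveI := hfin n
    haveI := hρfin n
    have := measure_tail_le (g := g) (ρ := ρ n) (hpos n) (hAre n)
      (ae_rho_abs_mul_le (hpos n) (hsupp n)) (K := 2 ^ (n + 3)) (by positivity)
      (ε := 4 * G / 2 ^ (n + 3)) (ω := 2 * G)
      (fun k hk => (hrep n k (hk.trans (hNle n)) (hkS_of_le n k hk)).trans (herrN n k hk))
      (fun k _ hk => ?_) (R := 2 * Real.pi / a) ?_
    · exact this
    · calc ‖g 0 - g (k * hh n)‖ ≤ ‖g 0‖ + ‖g (k * hh n)‖ := norm_sub_le _ _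
        _ ≤ G + G := add_le_add (hGS 0 (by simp [ha.le])) (hGS _ ?_)
        _ = 2 * G := by ring
      rw [abs_of_nonneg (by positivity : (0 : ℝ) ≤ k * hh n), ← hNh n]
      gcongr
    · have : a * (2 * Real.pi / a) = 2 * Real.pi := by field_simp
      rw [hNh n, this]
  have hball0 : ∀ n, (ρ n).real {x | |x| ≤ (((2 ^ n : ℕ) : ℝ) * hh n)⁻¹} ≤
      (2 * (2 * G) + 2 * (4 * G / 2 ^ (n + 3))) * (6 / (((2 ^ n : ℕ) : ℝ) * hh n) ^ 2) := by
    intro n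
    haveI := hfin n
    haveI := hρfin n
    have h2n : 2 ^ n ≤ 2 ^ (n + 3) := Nat.pow_le_pow_right (by norm_num) (by omega)
    exact measure_ball_le (g := g) (ρ := ρ n) (hpos n) (hAre n) (K := 2 ^ n) (by positivity)
      (ε := 4 * G / 2 ^ (n + 3)) (ω := 2 * G)
      (fun k hk => (hrep n k ((hk.trans h2n).trans (hNle n)) (hkS_of_le n k (hk.trans h2n))).trans
        (herrN n k (hk.trans h2n)))
      (fun k _ hk => by
        calc ‖g 0 - g (k * hh n)‖ ≤ ‖g 0‖ + ‖g (k * hh n)‖ := norm_sub_le _ _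
          _ ≤ G + G := add_le_add (hGS 0 (by simp [ha.le])) (hGS _ ?_)
          _ = 2 * G := by ring
        rw [abs_of_nonneg (by positivity : (0 : ℝ) ≤ k * hh n), ← hNh n]
        gcongr
        exact_mod_cast (hk.trans h2n))
  have hK1h : ∀ n, ((2 ^ n : ℕ) : ℝ) * hh n = a / 8 := fun n => by
    simp only [hhdef]; push_cast; rw [pow_add]; field_simp; ring
  -- uniform mass bound
  have hGe : ∀ n, 4 * G / 2 ^ (n + 3) ≤ G := fun n => by
    rw [div_le_iff₀ (by positivity)]
    have : (8 : ℝ) ≤ 2 ^ (n + 3) := by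
      calc (8 : ℝ) = 2 ^ 3 := by norm_num
        _ ≤ 2 ^ (n + 3) := pow_le_pow_right₀ (by norm_num) (by omega)
    nlinarith
  have hmass : ∀ n, (ρ n).real Set.univ ≤ 6 * G + 6 * G * (6 / (a / 8) ^ 2) := by
    intro n
    haveI := hρfin n
    have hcover : (Set.univ : Set ℝ) ⊆ {x | |x| ≤ (((2 ^ n : ℕ) : ℝ) * hh n)⁻¹} ∪
        {x | 2 * Real.pi / a ≤ |x|} := by
      intro x _
      by_cases hx : |x| ≤ (((2 ^ n : ℕ) : ℝ) * hh n)⁻¹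
      · exact Or.inl hx
      · right
        rw [not_le, hK1h n] at hx
        have : 2 * Real.pi / a ≤ (a / 8)⁻¹ := by
          rw [inv_div, div_le_div_iff₀ ha ha]; nlinarith
        exact this.trans hx.le
    calc (ρ n).real Set.univ ≤ (ρ n).real ({x | |x| ≤ (((2 ^ n : ℕ) : ℝ) * hh n)⁻¹} ∪
          {x | 2 * Real.pi / a ≤ |x|}) := measureReal_mono hcover
      _ ≤ (ρ n).real {x | |x| ≤ (((2 ^ n : ℕ) : ℝ) * hh n)⁻¹} +
          (ρ n).real {x | 2 * Real.pi / a ≤ |x|} := measureReal_union_le _ _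
      _ ≤ (2 * (2 * G) + 2 * (4 * G / 2 ^ (n + 3))) * (6 / (((2 ^ n : ℕ) : ℝ) * hh n) ^ 2) +
          (2 * (2 * G) + 2 * (4 * G / 2 ^ (n + 3))) := add_le_add (hball0 n) (htail0 n)
      _ ≤ 6 * G * (6 / (a / 8) ^ 2) + 6 * G := by
          rw [hK1h n]
          have h1 : 2 * (2 * G) + 2 * (4 * G / 2 ^ (n + 3)) ≤ 6 * G := by linarith [hGe n]
          gcongr
      _ = 6 * G + 6 * G * (6 / (a / 8) ^ 2) := by ring
  -- uniform bound for `A n` from the representation at `t = a`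
  set C0 : ℝ := 6 * G + 6 * G * (6 / (a / 8) ^ 2) with hC0
  have hAbd : ∀ n, ‖A n‖ ≤ (2 * G + (2 * a ^ 2 + 2 * |a| + 4) * C0 + G) / a := by
    intro n
    haveI := hρfin n
    have h1 := (hrep n (2 ^ (n + 3)) (hNle n) (hkS_of_le n _ le_rfl)).trans (herrN n _ le_rfl)
    rw [hNh n] at h1
    have h2 : ‖((a : ℝ) : ℂ) * A n‖ ≤ ‖g a - g 0‖ + ‖∫ x, (kreinHelicalIntegrand (a) (x) * (((1 : ℝ) + (x) ^ 2 : ℝ) : ℂ)) ∂(ρ n)‖ + 4 * G / 2 ^ (n + 3) := by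
      have : ((a : ℝ) : ℂ) * A n = (g a - g 0) - (∫ x, (kreinHelicalIntegrand (a) (x) * (((1 : ℝ) + (x) ^ 2 : ℝ) : ℂ)) ∂(ρ n)) -
          (g a - (g 0 + ((a : ℝ) : ℂ) * A n + ∫ x, (kreinHelicalIntegrand (a) (x) * (((1 : ℝ) + (x) ^ 2 : ℝ) : ℂ)) ∂(ρ n))) := by ring
      rw [this]
      refine (norm_sub_le _ _).trans (add_le_add ((norm_sub_le _ _).trans le_rfl) h1)
    rw [norm_mul, Complex.norm_real, Real.norm_eq_abs, abs_of_pos ha] at h2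
    rw [le_div_iff₀ ha, mul_comm]
    have h3 : ‖g a - g 0‖ ≤ 2 * G := by
      calc ‖g a - g 0‖ ≤ ‖g a‖ + ‖g 0‖ := norm_sub_le _ _
        _ ≤ G + G := add_le_add (hGS a (by rw [abs_of_pos ha])) (hGS 0 (by simp [ha.le]))
        _ = 2 * G := by ring
    have h4 := norm_integral_F_le (ρ n) a
    have h5 : (2 * a ^ 2 + 2 * |a| + 4) * (ρ n).real Set.univ ≤ (2 * a ^ 2 + 2 * |a| + 4) * C0 :=
      mul_le_mul_of_nonneg_left (hmass n) (by positivity)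
    linarith [hGe n]
  -- tightness at infinity
  have htight : ∀ ε : ℝ, 0 < ε → ∃ R : ℝ, ∀ᶠ n in atTop, (ρ n).real {x | R ≤ |x|} ≤ ε := by
    intro ε hε
    -- continuity of `g` at `0` within `S`
    obtain ⟨δ₀, hδ₀, hcont⟩ := Metric.continuousWithinAt_iff.1 (hg 0 h0S) (ε / 8) (by positivity)
    set δ : ℝ := min (δ₀ / 2) a with hδ
    have hδpos : 0 < δ := lt_min (by positivity) ha
    have hδa : δ ≤ a := min_le_right _ _
    have hδ₀' : δ < δ₀ := lt_of_le_of_lt (min_le_left _ _) (by linarith)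
    -- eventually `h n ≤ δ/2` and `4G/2^(n+3) ≤ ε/8`
    have hhto : Tendsto hh atTop (𝓝 0) := by
      simp only [hhdef]
      have : Tendsto (fun n : ℕ => a * (1 / 2) ^ (n + 3)) atTop (𝓝 (a * 0)) :=
        ((tendsto_pow_atTop_nhds_zero_of_lt_one (by norm_num) (by norm_num)).comp
          (tendsto_add_atTop_nat 3)).const_mul a
      rw [mul_zero] at this
      refine this.congr fun n => ?_
      simp [div_eq_mul_inv, inv_pow]
    have hev1 : ∀ᶠ n in atTop, hh n ≤ δ / 2 :=
      (hhto.eventually (ge_mem_nhds (by positivity : (0 : ℝ) < δ / 2))).mono fun n hn => hn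
    have herrto : Tendsto (fun n : ℕ => 4 * G / 2 ^ (n + 3)) atTop (𝓝 0) := by
      have : Tendsto (fun n : ℕ => 4 * G * (1 / 2) ^ (n + 3)) atTop (𝓝 (4 * G * 0)) :=
        ((tendsto_pow_atTop_nhds_zero_of_lt_one (by norm_num) (by norm_num)).comp
          (tendsto_add_atTop_nat 3)).const_mul (4 * G)
      rw [mul_zero] at this
      refine this.congr fun n => ?_
      simp [div_eq_mul_inv, inv_pow]
    have hev2 : ∀ᶠ n in atTop, 4 * G / 2 ^ (n + 3) ≤ ε / 8 :=
      (herrto.eventually (ge_mem_nhds (by positivity : (0 : ℝ) < ε / 8))).mono fun n hn => hn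
    refine ⟨4 * Real.pi / δ, ?_⟩
    filter_upwards [hev1, hev2] with n hn1 hn2
    haveI := hfin n
    haveI := hρfin n
    -- the averaging length `K = ⌊δ / h⌋`
    set K : ℕ := ⌊δ / hh n⌋₊ with hK
    have hKle : (K : ℝ) * hh n ≤ δ := by
      have := Nat.floor_le (by positivity : 0 ≤ δ / hh n)
      rw [← hK] at this
      calc (K : ℝ) * hh n ≤ δ / hh n * hh n := by gcongr
        _ = δ := div_mul_cancel₀ δ (hpos n).ne'
    have hKge : δ / 2 ≤ (K : ℝ) * hh n := by
      have := Nat.lt_floor_add_one (δ / hh n)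
      rw [← hK] at this
      have h1 : δ < ((K : ℝ) + 1) * hh n := by
        calc δ = δ / hh n * hh n := (div_mul_cancel₀ δ (hpos n).ne').symm
          _ < ((K : ℝ) + 1) * hh n := by gcongr
      nlinarith
    have hKpos : 0 < K := by
      by_contra h0
      simp only [not_lt, Nat.le_zero] at h0
      rw [h0, Nat.cast_zero, zero_mul] at hKge
      linarith
    have hKN : K ≤ 2 ^ (n + 3) := by
      have : (K : ℝ) * hh n ≤ (2 ^ (n + 3) : ℕ) * hh n := by
        rw [hNh n]; exact hKle.trans hδa
      exact_mod_cast le_of_mul_le_mul_right this (hpos n)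
    have htail := measure_tail_le (g := g) (ρ := ρ n) (hpos n) (hAre n)
      (ae_rho_abs_mul_le (hpos n) (hsupp n)) hKpos (ε := ε / 8) (ω := ε / 8)
      (fun k hk => ((hrep n k ((hk.trans hKN).trans (hNle n)) (hkS_of_le n k (hk.trans hKN))).trans
        (herrN n k (hk.trans hKN))).trans hn2)
      (fun k _ hk => ?_) (R := 4 * Real.pi / δ) ?_
    · rw [measureReal_def]; linarith
    · -- `‖g 0 - g (k h)‖ ≤ ε/8` by continuity at `0`, since `k h ≤ K h ≤ δ < δ₀`
      have hkh : (k : ℝ) * hh n ≤ δ := le_trans (by gcongr) hKle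
      have hmem : (k : ℝ) * hh n ∈ S := hmemS _ (by
        rw [abs_of_nonneg (by positivity : (0 : ℝ) ≤ k * hh n)]; linarith)
      have hdist : dist ((k : ℝ) * hh n) 0 < δ₀ := by
        rw [Real.dist_eq, sub_zero, abs_of_nonneg (by positivity : (0 : ℝ) ≤ k * hh n)]; linarith
      have := hcont hmem hdist
      rw [dist_comm, dist_eq_norm] at this
      exact this.le
    · calc 2 * Real.pi = δ / 2 * (4 * Real.pi / δ) := by field_simp; ring
        _ ≤ (K : ℝ) * hh n * (4 * Real.pi / δ) := by gcongr
  -- the representation at dyadic points, as `n → ∞`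
  have hdyadic : ∀ (m : ℕ) (j : ℤ), (j : ℝ) * (a / 2 ^ m) ∈ S →
      Tendsto (fun n => g (j * (a / 2 ^ m)) - (g 0 + ((j * (a / 2 ^ m) : ℝ) : ℂ) * A n +
        ∫ x, (kreinHelicalIntegrand (j * (a / 2 ^ m)) (x) * (((1 : ℝ) + (x) ^ 2 : ℝ) : ℂ)) ∂(ρ n))) atTop (𝓝 0) := by
    intro m j hjS
    set t : ℝ := j * (a / 2 ^ m) with ht
    -- the error bound `e n = 4 G |j|³ 2^{3(n+3-m)} / 2^{4(n+3)}` tends to `0`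
    have hbound : ∀ n, m ≤ n + 3 → j.natAbs * 2 ^ (n + 3 - m) ≤ 2 ^ (4 * (n + 3)) →
        ‖g t - (g 0 + ((t : ℝ) : ℂ) * A n + ∫ x, (kreinHelicalIntegrand (t) (x) * (((1 : ℝ) + (x) ^ 2 : ℝ) : ℂ)) ∂(ρ n))‖ ≤
          ((j.natAbs * 2 ^ (n + 3 - m) : ℕ) : ℝ) ^ 3 * (4 * G) / (2 ^ (4 * (n + 3)) : ℕ) := by
      intro n hmn hkM
      have hk : (((j.natAbs * 2 ^ (n + 3 - m) : ℕ) : ℝ)) * hh n = (j.natAbs : ℝ) * (a / 2 ^ m) := by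
        simp only [hhdef]; exact dyadic_mesh_eq_nat a hmn _
      have habsj : ((j.natAbs : ℕ) : ℝ) = |(j : ℝ)| := by
        rw [← Int.cast_natCast, Int.natCast_natAbs, Int.cast_abs]
      have htabs : |t| = (j.natAbs : ℝ) * (a / 2 ^ m) := by
        rw [ht, abs_mul, abs_of_pos (by positivity : (0 : ℝ) < a / 2 ^ m), habsj]
      have hkS : (((j.natAbs * 2 ^ (n + 3 - m) : ℕ) : ℝ)) * hh n ∈ S := by
        rw [hk, ← htabs]; exact hstar t hjS |t| (by rw [abs_abs])
      rcases le_or_gt 0 j with hj | hj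
      · have hkt : (((j.natAbs * 2 ^ (n + 3 - m) : ℕ) : ℝ)) * hh n = t := by
          rw [hk, habsj, ht, abs_of_nonneg (by exact_mod_cast hj)]
        have h := hrep n _ hkM hkS
        rwa [hkt] at h
      · have hkt : -((((j.natAbs * 2 ^ (n + 3 - m) : ℕ) : ℝ)) * hh n) = t := by
          rw [hk, habsj, ht, abs_of_neg (by exact_mod_cast hj)]; ring
        have h := hrep_neg n _ hkM hkS
        rwa [hkt] at h
    -- `e n → 0`
    have hev1 : ∀ᶠ n : ℕ in atTop, m ≤ n + 3 := (eventually_ge_atTop m).mono fun n hn => by omega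
    have hev2 : ∀ᶠ n : ℕ in atTop, j.natAbs * 2 ^ (n + 3 - m) ≤ 2 ^ (4 * (n + 3)) := by
      -- `|j| ≤ 2^(3(n+3))` eventually
      obtain ⟨N₀, hN₀⟩ : ∃ N₀ : ℕ, j.natAbs ≤ 2 ^ N₀ := ⟨j.natAbs, Nat.lt_two_pow_self.le⟩
      filter_upwards [eventually_ge_atTop N₀] with n hn
      calc j.natAbs * 2 ^ (n + 3 - m) ≤ 2 ^ N₀ * 2 ^ (n + 3) :=
            Nat.mul_le_mul hN₀ (Nat.pow_le_pow_right (by norm_num) (by omega))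
        _ ≤ 2 ^ (3 * (n + 3)) * 2 ^ (n + 3) := by
            apply Nat.mul_le_mul_right
            exact Nat.pow_le_pow_right (by norm_num) (by omega)
        _ = 2 ^ (4 * (n + 3)) := by rw [← pow_add]; ring_nf
    have herr : Tendsto (fun n : ℕ => ((j.natAbs * 2 ^ (n + 3 - m) : ℕ) : ℝ) ^ 3 * (4 * G) /
        (2 ^ (4 * (n + 3)) : ℕ)) atTop (𝓝 0) := by
      -- for `m ≤ n + 3` the quantity is `4 G |j|³ / (2^{3m} 2^{n+3})`
      have heq : ∀ᶠ n : ℕ in atTop, ((j.natAbs * 2 ^ (n + 3 - m) : ℕ) : ℝ) ^ 3 * (4 * G) /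
          (2 ^ (4 * (n + 3)) : ℕ) = (4 * G * (j.natAbs : ℝ) ^ 3 / 2 ^ (3 * m)) * (2 ^ (n + 3))⁻¹ := by
        filter_upwards [hev1] with n hmn
        have h2 : (2 : ℝ) ^ (n + 3) = 2 ^ m * 2 ^ (n + 3 - m) := by
          rw [← pow_add, Nat.add_sub_cancel' hmn]
        push_cast
        rw [show (2 : ℝ) ^ (4 * (n + 3)) = (2 ^ (n + 3)) ^ 4 by rw [← pow_mul]; ring_nf,
          show (2 : ℝ) ^ (3 * m) = (2 ^ m) ^ 3 by rw [← pow_mul]; ring_nf, h2]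
        field_simp
      have hlim : Tendsto (fun n : ℕ => (4 * G * (j.natAbs : ℝ) ^ 3 / 2 ^ (3 * m)) * (2 ^ (n + 3))⁻¹)
          atTop (𝓝 ((4 * G * (j.natAbs : ℝ) ^ 3 / 2 ^ (3 * m)) * 0)) :=
        (tendsto_inv_atTop_zero.comp ((tendsto_pow_atTop_atTop_of_one_lt one_lt_two).comp
          (tendsto_add_atTop_nat 3))).const_mul _
      rw [mul_zero] at hlim
      exact hlim.congr' (heq.mono fun n hn => hn.symm)
    rw [tendsto_zero_iff_norm_tendsto_zero]
    refine squeeze_zero' (Eventually.of_forall fun n => norm_nonneg _) ?_ herr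
    filter_upwards [hev1, hev2] with n h1 h2
    exact hbound n h1 h2
  exact ⟨ρ, A, hρfin, hAre, ⟨C0, hmass⟩, ⟨_, hAbd⟩, htight, hdyadic⟩

end Package

end Literature.Analysis.InverseSpectral
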